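import Mathlib.RingTheory.Localization.FractionRing
import Literature.Computability.AlgebraicComplexity.DDS21DepthThreeDiagonalToolkit
import HarnessLib

/-!
# Dutta–Dwivedi–Saxena 2021, Def. 3.1: the bloated class `Gen(k, s)` as data

Topic `Literature/Computability/AlgebraicComplexity`; cell `val-lit`, row X2-DDS21, brick **B3** of the
`DDS2021_thm_3_2` / `DDS2021_thm_5_1` programme (lead-np RULING (128)). Source: P. Dutta, P. Dwivedi,
N. Saxena, *Demystifying the border of depth-3 algebraic circuits*, FOCS 2021 [DuttaDwivediSaxena2022],
held full version `paper:galaxy-pdf-7641649743695546420` (chunk `pNNNN.txt`, printed line `Lnnn`).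

## What is here

* §1 **Def. 3.1 as DATA** (p0026 L702–707: "A circuit `C` is defined to be in bloated class
  `Gen(k, s)` over the ring of rational functions `R(x)`, with parameter `k` and size `s`, if it
  computes `f ∈ R(x)` where `f = Σ_{i∈[k]} T_i`, such that `T_i = (U_i/V_i)·P_i/Q_i`, with
  `U_i, V_i, P_i, Q_i ∈ R[x]` such that `U_i, V_i ∈ ΠΣ` and `P_i, Q_i ∈ Σ∧Σ`. Further,
  `size(C) = Σ_{i∈[k]} size(T_i)`, and `size(T_i) = size(U_i) + size(V_i) + size(P_i) + size(Q_i)`").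
  `GenTerm K n d t e` = one term `(U/V)·(P/Q)` with `U, V ∈ ΠΣ = spsClass K n 1 d`,
  `P, Q ∈ Σ∧Σ = swsClass K n t e`, `V, Q ≠ 0`; `GenCircuit K n d t e k = Fin k → GenTerm …` = a
  `Gen(k, ·)` circuit. Its value: `GenCircuit.val` in the fraction field `FractionRing (K[x])`
  (`= num/den`, `val_eq_num_div_den`, common denominator `den = Π_i V_i Q_i ≠ 0`) and, for users
  who prefer polynomial identities, the CLEARED predicate `GenCircuit.Computes C a b :↔ a·den = b·num`
  (`computes_iff_val`). SIZE CONVENTION: the print's scalar size `s` is replaced by uniform SHAPE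
  parameters `(d, t, e)` per circuit (bottom fan-in `d` of the `ΠΣ` parts, top fan-in `t` and exponent
  bound `e` of the `Σ∧Σ` parts); `GenCircuit.size = k·(2d(n+1) + 2t(e+n+1))` is the printed size up
  to constants (a `ΠΣ` product of `d` affine forms has size `≍ d(n+1)`, a `Σ∧Σ(t,e)` circuit
  `≍ t(e+n)`, §2.3 p0020 L537–540); every ABP budget below is an explicit polynomial in
  `(n, d, t, e)`, to be absorbed once by the `∃ c` of `DDS2021_thm_3_2`.
* §2 **Closure basics**: `GenCircuit.append` (`Gen(k₁) + Gen(k₂) ⊆ Gen(k₁+k₂)`, `val_append`),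
  `GenCircuit.single` (a term as a `Gen(1)` circuit), `GenTerm.smul` / `GenCircuit.smul` (scalars,
  absorbed in `P`), `GenTerm.mul` / `GenTerm.inv` (the products and divisions of terms used by the
  DiDIL step `T_{i,j}/T̃_{k-j,j}`, with the shape arithmetic of `mul_mem_spsClass_one` and Lemma 2.12
  `mul_mem_swsClass`), and "size-`s` `Σ^{[k]}ΠΣ` lies in `Gen(k, s)`"
  (p0026 L708; `exists_genCircuit_of_mem_spsClass`: `f ∈ spsClass K n k d ⇒` a `Gen(k)` circuit
  with value `f`, terms `(T_i/1)·(1/1)`).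
* §3 (companion file `DDS21GenOneABP.lean`) carries the ABP side of Claim 3.3
  (`\overline{Gen(1,s)} ⊆ ABP/ABP`) and of Claim 3.8's limit step, glued from t19 g11's `ε → 0`
  lemmas (`DDS21BloatedRatioDeborder.lean`) and the tree's `ΠΣ ⊆ ABP` / `\overline{Σ∧Σ} ⊆ ABP`
  (`UABPToolkit.lean`, `DDS21DeborderReadOnce.lean`).

What this is NOT: the DiDIL step (Claims 3.4–3.6, brick B4), the trace-back (Claims 3.7–3.8, B5) and
the `mod z^{d_j}` frame are not addressed; `DDS2021_thm_3_2` / `_5_1` stay named facts. Honest framing: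
definitions + bookkeeping toward a published 2021 upper bound; nothing here bears on VP versus VNP,
which is NOT proved.

## References

* [DuttaDwivediSaxena2022] P. Dutta, P. Dwivedi, N. Saxena, *Demystifying the border of depth-3
  algebraic circuits*, Proc. 62nd FOCS (2021), IEEE 2022, 92–103; full version
  `paper:galaxy-pdf-7641649743695546420`: Def. 3.1 p0026 L702–708, Thm. 3.2 p0026 L710–712,
  Claim 3.3 p0027 L724–744, §2.3 p0020 L537–540 (sizes), Lemma 2.23 p0025 L661–664.
-/

noncomputable section

open MvPolynomial
open scoped BigOperators Polynomial

namespace Literature.Computability.AlgebraicComplexity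

namespace DDS2021

/-! ### §1 Def. 3.1 as data: terms `(U/V)·(P/Q)` and `Gen(k, ·)` circuits -/

section Data

variable (K : Type*) [Field K] (n d t e : ℕ)

/-- **DDS Def. 3.1, one term of the bloated class**: `T = (U/V)·(P/Q)` with `U, V ∈ ΠΣ`
(`spsClass K n 1 d`: ONE product of `d` affine forms), `P, Q ∈ Σ∧Σ` (`swsClass K n t e`), and
nonzero denominators `V, Q` (p0026 L704–706). Shape parameters `(d, t, e)` replace the printed size,
see the module docstring (SIZE CONVENTION).
[cite: DuttaDwivediSaxena2022, Def. 3.1 (full version p0026 L702–707)] -/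
structure GenTerm where
  /-- the `ΠΣ` numerator factor `U` -/
  U : MvPolynomial (Fin n) K
  /-- the `ΠΣ` denominator factor `V` -/
  V : MvPolynomial (Fin n) K
  /-- the `Σ∧Σ` numerator factor `P` -/
  P : MvPolynomial (Fin n) K
  /-- the `Σ∧Σ` denominator factor `Q` -/
  Q : MvPolynomial (Fin n) K
  /-- `U ∈ ΠΣ` -/
  U_mem : U ∈ spsClass K n 1 d
  /-- `V ∈ ΠΣ` -/
  V_mem : V ∈ spsClass K n 1 d
  /-- `P ∈ Σ∧Σ` -/
  P_mem : P ∈ swsClass K n t e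
  /-- `Q ∈ Σ∧Σ` -/
  Q_mem : Q ∈ swsClass K n t e
  /-- `V ≠ 0` -/
  V_ne_zero : V ≠ 0
  /-- `Q ≠ 0` -/
  Q_ne_zero : Q ≠ 0

/-- **DDS Def. 3.1, a `Gen(k, ·)` circuit**: `k` terms `T_i = (U_i/V_i)·(P_i/Q_i)` of uniform shape
`(d, t, e)`, computing `Σ_i T_i` (p0026 L702–707). [cite: DuttaDwivediSaxena2022, Def. 3.1 (full version p0026 L702–707)] -/
def GenCircuit (k : ℕ) : Type _ := Fin k → GenTerm K n d t e

end Data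

section PiSigma

variable {K : Type*} [Field K] {n : ℕ}

/-- **`ΠΣ` is closed under products**: a product of `d₁` affine forms times a product of `d₂` affine
forms is a product of `d₁ + d₂` affine forms (the bloated classes are built from the base classes by
"sum, product, and division", §2.1 p0017 L457–459). [cite: DuttaDwivediSaxena2022, §2.1 (full version p0017 L457–459)] -/
theorem mul_mem_spsClass_one {d₁ d₂ : ℕ} {U₁ U₂ : MvPolynomial (Fin n) K}
    (h₁ : U₁ ∈ spsClass K n 1 d₁) (h₂ : U₂ ∈ spsClass K n 1 d₂) :
    U₁ * U₂ ∈ spsClass K n 1 (d₁ + d₂) := by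
  obtain ⟨α₁, rfl⟩ := h₁
  obtain ⟨α₂, rfl⟩ := h₂
  refine ⟨fun i => Fin.append (α₁ i) (α₂ i), ?_⟩
  simp only [Finset.univ_unique, Fin.default_eq_zero, Finset.sum_singleton, Fin.prod_univ_add,
    Fin.append_left, Fin.append_right]

end PiSigma

namespace GenTerm

variable {K : Type*} [Field K] {n d t e : ℕ}

/-- Numerator `U·P` of the term `(U/V)·(P/Q)`. [cite: DuttaDwivediSaxena2022, Def. 3.1 (full version p0026 L704–706)] -/
def num (T : GenTerm K n d t e) : MvPolynomial (Fin n) K := T.U * T.P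

/-- Denominator `V·Q` of the term `(U/V)·(P/Q)`. [cite: DuttaDwivediSaxena2022, Def. 3.1 (full version p0026 L704–706)] -/
def den (T : GenTerm K n d t e) : MvPolynomial (Fin n) K := T.V * T.Q

/-- The denominator of a term is nonzero. [cite: DuttaDwivediSaxena2022, Def. 3.1 (full version p0026 L704–706)] -/
theorem den_ne_zero (T : GenTerm K n d t e) : T.den ≠ 0 := mul_ne_zero T.V_ne_zero T.Q_ne_zero

/-- The value `(U·P)/(V·Q)` of a term in the field of rational functions `K(x)`.
[cite: DuttaDwivediSaxena2022, Def. 3.1 (full version p0026 L704–706)] -/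
def val (T : GenTerm K n d t e) : FractionRing (MvPolynomial (Fin n) K) :=
  algebraMap (MvPolynomial (Fin n) K) (FractionRing (MvPolynomial (Fin n) K)) T.num /
    algebraMap (MvPolynomial (Fin n) K) (FractionRing (MvPolynomial (Fin n) K)) T.den

/-- **Scalars**: `c·T` is again a `Gen` term of the same shape (the scalar is absorbed in the `Σ∧Σ`
factor `P`, which is closed under scalars: `C_mul_mem_swsClass`). [cite: DuttaDwivediSaxena2022, Def. 3.1 (full version p0026 L702–707)] -/
def smul (c : K) (T : GenTerm K n d t e) : GenTerm K n d t e where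
  U := T.U
  V := T.V
  P := C c * T.P
  Q := T.Q
  U_mem := T.U_mem
  V_mem := T.V_mem
  P_mem := C_mul_mem_swsClass c T.P_mem
  Q_mem := T.Q_mem
  V_ne_zero := T.V_ne_zero
  Q_ne_zero := T.Q_ne_zero

/-- `num (c·T) = c · num T`. [cite: DuttaDwivediSaxena2022, Def. 3.1 (full version p0026 L704–706)] -/
theorem num_smul (c : K) (T : GenTerm K n d t e) : (T.smul c).num = C c * T.num := by
  simp only [num, smul]
  ring

/-- `den (c·T) = den T`. [cite: DuttaDwivediSaxena2022, Def. 3.1 (full version p0026 L704–706)] -/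
theorem den_smul (c : K) (T : GenTerm K n d t e) : (T.smul c).den = T.den := rfl

/-- `val (c·T) = c · val T`. [cite: DuttaDwivediSaxena2022, Def. 3.1 (full version p0026 L704–706)] -/
theorem val_smul (c : K) (T : GenTerm K n d t e) :
    (T.smul c).val = algebraMap (MvPolynomial (Fin n) K) (FractionRing (MvPolynomial (Fin n) K))
      (C c) * T.val := by
  rw [val, val, num_smul, den_smul, map_mul, mul_div_assoc]

/-- **Products of terms** ("any combination of sum, product, and division", §2.1 p0017 L457–459;
the DiDIL step forms `T_{i,j}/T̃_{k-j,j}`, p0031): `(U₁/V₁)(P₁/Q₁) · (U₂/V₂)(P₂/Q₂)` is a term of shape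
`(d₁+d₂, t₁t₂(e₁+e₂+1), e₁+e₂)` (`ΠΣ`: `mul_mem_spsClass_one`; `Σ∧Σ`: Lemma 2.12 `mul_mem_swsClass`,
`DDS21DepthThreeDiagonalToolkit.lean`). [cite: DuttaDwivediSaxena2022, Def. 3.1 and Lemma 2.12 (full version p0026 L702–707, p0020)] -/
def mul [CharZero K] {d₁ t₁ e₁ d₂ t₂ e₂ : ℕ} (T₁ : GenTerm K n d₁ t₁ e₁) (T₂ : GenTerm K n d₂ t₂ e₂) :
    GenTerm K n (d₁ + d₂) (t₁ * t₂ * (e₁ + e₂ + 1)) (e₁ + e₂) where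
  U := T₁.U * T₂.U
  V := T₁.V * T₂.V
  P := T₁.P * T₂.P
  Q := T₁.Q * T₂.Q
  U_mem := mul_mem_spsClass_one T₁.U_mem T₂.U_mem
  V_mem := mul_mem_spsClass_one T₁.V_mem T₂.V_mem
  P_mem := mul_mem_swsClass T₁.P_mem T₂.P_mem
  Q_mem := mul_mem_swsClass T₁.Q_mem T₂.Q_mem
  V_ne_zero := mul_ne_zero T₁.V_ne_zero T₂.V_ne_zero
  Q_ne_zero := mul_ne_zero T₁.Q_ne_zero T₂.Q_ne_zero

/-- `num (T₁·T₂) = num T₁ · num T₂`. [cite: DuttaDwivediSaxena2022, Def. 3.1 (full version p0026 L704–706)] -/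
theorem num_mul [CharZero K] {d₁ t₁ e₁ d₂ t₂ e₂ : ℕ} (T₁ : GenTerm K n d₁ t₁ e₁)
    (T₂ : GenTerm K n d₂ t₂ e₂) : (T₁.mul T₂).num = T₁.num * T₂.num := by
  simp only [num, mul]
  ring

/-- `den (T₁·T₂) = den T₁ · den T₂`. [cite: DuttaDwivediSaxena2022, Def. 3.1 (full version p0026 L704–706)] -/
theorem den_mul [CharZero K] {d₁ t₁ e₁ d₂ t₂ e₂ : ℕ} (T₁ : GenTerm K n d₁ t₁ e₁)
    (T₂ : GenTerm K n d₂ t₂ e₂) : (T₁.mul T₂).den = T₁.den * T₂.den := by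
  simp only [den, mul]
  ring

/-- `val (T₁·T₂) = val T₁ · val T₂`. [cite: DuttaDwivediSaxena2022, Def. 3.1 (full version p0026 L704–706)] -/
theorem val_mul [CharZero K] {d₁ t₁ e₁ d₂ t₂ e₂ : ℕ} (T₁ : GenTerm K n d₁ t₁ e₁)
    (T₂ : GenTerm K n d₂ t₂ e₂) : (T₁.mul T₂).val = T₁.val * T₂.val := by
  rw [val, val, val, num_mul, den_mul, map_mul, map_mul, div_mul_div_comm]

/-- **Inverse of a term with nonzero numerator factors**: `((U/V)(P/Q))⁻¹ = (V/U)(Q/P)` (the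
division used by the DiDIL step, "divide `Φ(g_0)` by `T̃_{k,0}`", p0028 L763–765).
[cite: DuttaDwivediSaxena2022, Def. 3.1 and §3 "Divide and derive" (full version p0026 L702–707, p0028 L763–765)] -/
def inv (T : GenTerm K n d t e) (hU : T.U ≠ 0) (hP : T.P ≠ 0) : GenTerm K n d t e where
  U := T.V
  V := T.U
  P := T.Q
  Q := T.P
  U_mem := T.V_mem
  V_mem := T.U_mem
  P_mem := T.Q_mem
  Q_mem := T.P_mem
  V_ne_zero := hU
  Q_ne_zero := hP

/-- `num T⁻¹ = den T`. [cite: DuttaDwivediSaxena2022, Def. 3.1 (full version p0026 L704–706)] -/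
theorem num_inv (T : GenTerm K n d t e) (hU : T.U ≠ 0) (hP : T.P ≠ 0) :
    (T.inv hU hP).num = T.den := rfl

/-- `den T⁻¹ = num T`. [cite: DuttaDwivediSaxena2022, Def. 3.1 (full version p0026 L704–706)] -/
theorem den_inv (T : GenTerm K n d t e) (hU : T.U ≠ 0) (hP : T.P ≠ 0) :
    (T.inv hU hP).den = T.num := rfl

/-- `val T⁻¹ = (val T)⁻¹`. [cite: DuttaDwivediSaxena2022, Def. 3.1 (full version p0026 L704–706)] -/
theorem val_inv (T : GenTerm K n d t e) (hU : T.U ≠ 0) (hP : T.P ≠ 0) :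
    (T.inv hU hP).val = T.val⁻¹ := by
  rw [val, val, num_inv, den_inv, inv_div]

end GenTerm

namespace GenCircuit

variable {K : Type*} [Field K] {n d t e k : ℕ}

/-- **The printed size of a `Gen(k, ·)` circuit, up to constants** (Def. 3.1: `size(C) = Σ_i
size(T_i)`, `size(T_i) = size(U_i)+size(V_i)+size(P_i)+size(Q_i)`), as a function of the shape:
each `ΠΣ` part counts `d(n+1)`, each `Σ∧Σ` part `t(e+n+1)` (SIZE CONVENTION of the module docstring).
[cite: DuttaDwivediSaxena2022, Def. 3.1 and §2.3 (full version p0026 L706–707, p0020 L537–540)] -/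
def size (_G : GenCircuit K n d t e k) : ℕ := k * (2 * (d * (n + 1)) + 2 * (t * (e + n + 1)))

/-- Common denominator `Π_i V_i Q_i` of a `Gen(k, ·)` circuit. [cite: DuttaDwivediSaxena2022, Def. 3.1 (full version p0026 L702–707)] -/
def den (G : GenCircuit K n d t e k) : MvPolynomial (Fin n) K := ∏ i, (G i).den

/-- Numerator over the common denominator: `Σ_i U_i P_i · Π_{j ≠ i} V_j Q_j`.
[cite: DuttaDwivediSaxena2022, Def. 3.1 (full version p0026 L702–707)] -/
def num (G : GenCircuit K n d t e k) : MvPolynomial (Fin n) K :=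
  ∑ i, (G i).num * ∏ j ∈ Finset.univ.erase i, (G j).den

/-- The common denominator is nonzero. [cite: DuttaDwivediSaxena2022, Def. 3.1 (full version p0026 L702–707)] -/
theorem den_ne_zero (G : GenCircuit K n d t e k) : G.den ≠ 0 :=
  Finset.prod_ne_zero_iff.2 fun i _ => (G i).den_ne_zero

/-- **The rational function computed by a `Gen(k, ·)` circuit**, `f = Σ_i T_i ∈ K(x)` (Def. 3.1:
"it computes `f ∈ R(x)` where `f = Σ_{i∈[k]} T_i`"). [cite: DuttaDwivediSaxena2022, Def. 3.1 (full version p0026 L702–704)] -/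
def val (G : GenCircuit K n d t e k) : FractionRing (MvPolynomial (Fin n) K) := ∑ i, (G i).val

/-- `f = num/den` over the common denominator. [cite: DuttaDwivediSaxena2022, Def. 3.1 (full version p0026 L702–707)] -/
theorem val_eq_num_div_den (G : GenCircuit K n d t e k) :
    G.val = algebraMap (MvPolynomial (Fin n) K) (FractionRing (MvPolynomial (Fin n) K)) G.num /
      algebraMap (MvPolynomial (Fin n) K) (FractionRing (MvPolynomial (Fin n) K)) G.den := by
  classical
  set ι := algebraMap (MvPolynomial (Fin n) K) (FractionRing (MvPolynomial (Fin n) K)) with hι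
  have hinj : Function.Injective ι := IsFractionRing.injective _ _
  have hden : ι G.den ≠ 0 := (map_ne_zero_iff ι hinj).2 G.den_ne_zero
  rw [eq_div_iff hden, val, Finset.sum_mul, num, map_sum]
  refine Finset.sum_congr rfl fun i _ => ?_
  have hdi : ι (G i).den ≠ 0 := (map_ne_zero_iff ι hinj).2 (G i).den_ne_zero
  rw [GenTerm.val, den, ← Finset.mul_prod_erase Finset.univ (fun j => (G j).den) (Finset.mem_univ i),
    map_mul, map_mul, map_prod, ← hι, div_mul_eq_mul_div, div_eq_iff hdi]
  ring

/-- **Cleared currency**: the circuit `C` "computes the fraction `a/b`" iff `a · den C = b · num C`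
(a polynomial identity; `b ≠ 0` is the user's side condition). [cite: DuttaDwivediSaxena2022, Def. 3.1 (full version p0026 L702–707)] -/
def Computes (G : GenCircuit K n d t e k) (a b : MvPolynomial (Fin n) K) : Prop :=
  a * G.den = b * G.num

/-- The cleared currency agrees with the value in `K(x)`: for `b ≠ 0`, `C` computes `a/b` iff
`val C = a/b`. [cite: DuttaDwivediSaxena2022, Def. 3.1 (full version p0026 L702–707)] -/
theorem computes_iff_val (G : GenCircuit K n d t e k) {a b : MvPolynomial (Fin n) K} (hb : b ≠ 0) :
    G.Computes a b ↔
      G.val = algebraMap (MvPolynomial (Fin n) K) (FractionRing (MvPolynomial (Fin n) K)) a /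
        algebraMap (MvPolynomial (Fin n) K) (FractionRing (MvPolynomial (Fin n) K)) b := by
  set ι := algebraMap (MvPolynomial (Fin n) K) (FractionRing (MvPolynomial (Fin n) K)) with hι
  have hinj : Function.Injective ι := IsFractionRing.injective _ _
  have hbι : ι b ≠ 0 := (map_ne_zero_iff ι hinj).2 hb
  have hden : ι G.den ≠ 0 := (map_ne_zero_iff ι hinj).2 G.den_ne_zero
  rw [val_eq_num_div_den, ← hι, div_eq_div_iff hden hbι, Computes, ← hinj.eq_iff, map_mul, map_mul]
  constructor
  · intro h
    linear_combination -h
  · intro h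
    linear_combination -h

/-! ### §2 Closure basics -/

/-- **`Gen(k₁) + Gen(k₂) ⊆ Gen(k₁ + k₂)`**: juxtaposition of the term lists.
[cite: DuttaDwivediSaxena2022, Def. 3.1 (full version p0026 L702–707)] -/
def append {k₁ k₂ : ℕ} (C₁ : GenCircuit K n d t e k₁) (C₂ : GenCircuit K n d t e k₂) :
    GenCircuit K n d t e (k₁ + k₂) :=
  Fin.append C₁ C₂

/-- The juxtaposed circuit computes the sum. [cite: DuttaDwivediSaxena2022, Def. 3.1 (full version p0026 L702–707)] -/
theorem val_append {k₁ k₂ : ℕ} (C₁ : GenCircuit K n d t e k₁) (C₂ : GenCircuit K n d t e k₂) :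
    (C₁.append C₂).val = C₁.val + C₂.val := by
  rw [val, val, val, Fin.sum_univ_add]
  simp only [append, Fin.append_left, Fin.append_right]

/-- The size is additive under juxtaposition (Def. 3.1: `size(C) = Σ size(T_i)`).
[cite: DuttaDwivediSaxena2022, Def. 3.1 (full version p0026 L706–707)] -/
theorem size_append {k₁ k₂ : ℕ} (C₁ : GenCircuit K n d t e k₁) (C₂ : GenCircuit K n d t e k₂) :
    (C₁.append C₂).size = C₁.size + C₂.size := by
  simp only [size]
  ring

/-- A single term as a `Gen(1, ·)` circuit. [cite: DuttaDwivediSaxena2022, Def. 3.1 (full version p0026 L702–707)] -/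
def single (T : GenTerm K n d t e) : GenCircuit K n d t e 1 := fun _ => T

/-- `den (single T) = den T`. [cite: DuttaDwivediSaxena2022, Def. 3.1 (full version p0026 L702–707)] -/
theorem den_single (T : GenTerm K n d t e) : (single T).den = T.den := by
  simp [den, single]

/-- `num (single T) = num T`. [cite: DuttaDwivediSaxena2022, Def. 3.1 (full version p0026 L702–707)] -/
theorem num_single (T : GenTerm K n d t e) : (single T).num = T.num := by
  simp [num, single]

/-- `val (single T) = val T`. [cite: DuttaDwivediSaxena2022, Def. 3.1 (full version p0026 L702–707)] -/
theorem val_single (T : GenTerm K n d t e) : (single T).val = T.val := by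
  simp [val, single]

/-- **Scalars**: `c · G`, termwise (`GenTerm.smul`). [cite: DuttaDwivediSaxena2022, Def. 3.1 (full version p0026 L702–707)] -/
def smul (c : K) (G : GenCircuit K n d t e k) : GenCircuit K n d t e k := fun i => (G i).smul c

/-- `val (c · G) = c · val G`. [cite: DuttaDwivediSaxena2022, Def. 3.1 (full version p0026 L702–707)] -/
theorem val_smul (c : K) (G : GenCircuit K n d t e k) :
    (G.smul c).val = algebraMap (MvPolynomial (Fin n) K) (FractionRing (MvPolynomial (Fin n) K))
      (C c) * G.val := by
  rw [val, val, Finset.mul_sum]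
  exact Finset.sum_congr rfl fun i _ => GenTerm.val_smul c (G i)

/-- The size is unchanged by scalars (shape parameters are unchanged).
[cite: DuttaDwivediSaxena2022, Def. 3.1 (full version p0026 L706–707)] -/
theorem size_smul (c : K) (G : GenCircuit K n d t e k) : (G.smul c).size = G.size := rfl

/-- `1 ∈ ΠΣ` with one product gate of any bottom fan-in `d` (all `d` affine forms equal to `1`).
[cite: DuttaDwivediSaxena2022, §1.1 (full version p0006 L120–121)] -/
theorem one_mem_spsClass_one : (1 : MvPolynomial (Fin n) K) ∈ spsClass K n 1 d := by
  refine ⟨fun _ _ o => if o = none then 1 else 0, ?_⟩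
  simp

/-- **"Size-`s` `Σ^{[k]}Π^{[d]}Σ` lies in `Gen(k, s)`"** (p0026 L708): every `f ∈ spsClass K n k d` is
the value of a `Gen(k, ·)` circuit of shape `(d, t, e)` for any `t ≥ 1` (terms `(T_i/1)·(1/1)`),
in both currencies. [cite: DuttaDwivediSaxena2022, Def. 3.1 and the sentence after it (full version p0026 L702–708)] -/
theorem exists_genCircuit_of_mem_spsClass (ht : 1 ≤ t) {f : MvPolynomial (Fin n) K}
    (hf : f ∈ spsClass K n k d) :
    ∃ G : GenCircuit K n d t e k, G.den = 1 ∧ G.num = f ∧ G.Computes f 1 := by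
  obtain ⟨α, hfα⟩ := hf
  have h1sws : (1 : MvPolynomial (Fin n) K) ∈ swsClass K n t e :=
    swsClass_mono ht (Nat.zero_le e) one_mem_swsClass
  let T : Fin k → GenTerm K n d t e := fun i =>
    { U := ∏ j : Fin d, (C (α i j none) + ∑ m : Fin n, C (α i j (some m)) * X m)
      V := 1
      P := 1
      Q := 1
      U_mem := ⟨fun _ => α i, by simp⟩
      V_mem := one_mem_spsClass_one
      P_mem := h1sws
      Q_mem := h1sws
      V_ne_zero := one_ne_zero
      Q_ne_zero := one_ne_zero }
  have hden : ∀ i, (T i).den = 1 := fun i => by simp [T, GenTerm.den]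
  have hnum : ∀ i, (T i).num =
      ∏ j : Fin d, (C (α i j none) + ∑ m : Fin n, C (α i j (some m)) * X m) := fun i => by
    simp [T, GenTerm.num]
  have hCden : GenCircuit.den T = 1 := by simp [GenCircuit.den, hden]
  have hCnum : GenCircuit.num T = f := by
    rw [GenCircuit.num, hfα]
    refine Finset.sum_congr rfl fun i _ => ?_
    rw [hnum, Finset.prod_eq_one fun j _ => hden j, mul_one]
  exact ⟨T, hCden, hCnum, by unfold Computes; rw [hCden, hCnum, mul_one, one_mul]⟩

end GenCircuit

end DDS2021

end Literature.Computability.AlgebraicComplexity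

end
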